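import Summits.BirchSwinnertonDyer.BirchSwinnertonDyer.Theorems.PrintCFramBottomClassIndexLawFiveLeEisensteinPairBernoulli
import HarnessLib

/-!
# Crux `PrintCFram.BottomClassIndexLawFiveLe` (stmt-BirchSwinnertonDyer-20372), line `eisenstein-resource-bdp-line` (registry v10):
# THE BERNOULLI UNITS OF THE KRIZ–LI DATUM, part M — MAZUR–WILES' CURRENCY: `bernoulliOnePrim` vs `generalizedBernoulli 1 χ̃⁻¹`,
# parity of primitive characters, `‖B_{1,ω⁻¹}‖_p = p` («`χ ≠ ω`» IS AUTOMATIC), parities of Kriz–Li's two characters, `ε_K⁻¹ = ε_K`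
# (cell `bsd-print-cfram`, width seat `bsd-line-cfram-p1-w3` g4; THEOREMS ONLY, `--supports` 20372; BSD is not proved by any of this)

HONEST FRAMING. Nothing here is a statement about BSD; no stub of the skeleton is closed. Mazur–Wiles' Thm. 2 as typed by w8
(`Literature.NumberTheory.NumberFields.MazurWiles1984.thm2_oddChiPart_classGroup_card_eq_pow_val_bernoulli`) takes a PRIMITIVE,
ODD Dirichlet character `χ` of level `f`, the clause «`χ ≠ ω`» spelled `¬ (f = p ∧ ∀ a ⊥ p, ‖χ a − a‖ < 1)`, and concludes with
`‖generalizedBernoulli 1 χ⁻¹‖`. Kriz–Li's numbers live in the tree as `bernoulliOnePrim` of (possibly imprimitive) product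
characters. This file is the dictionary between the two currencies, generic in `χ`:

* `bernoulliOnePrim_eq_generalizedBernoulli_of_isPrimitive`, **`generalizedBernoulli_primitiveCharacter_inv`**
  (`B_{1,χ̃⁻¹} = bernoulliOnePrim χ⁻¹` for `χ̃ = χ.primitiveCharacter`), `primitiveCharacter_odd_iff` / `_even_iff`;
* **`norm_generalizedBernoulli_teichmuller_inv`** (`‖B_{1,ω⁻¹}‖_p = p`: `Σ_{a<p} ω(a)⁻¹ a ≡ p − 1 (mod p)`) and
  **`not_isTeichmuller_of_norm_generalizedBernoulli_inv_le_one`**: Mazur–Wiles' `hω` is DISCHARGED by `hB` for every consumer;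
* parities: `evenTwist_even`, `bernoulliCharOne_odd`, `bernoulliCharTwo_odd` (for `ε_K`, `ω` odd);
* `inv_eq_self_of_isKroneckerCharacterOf`: `ε_K` is quadratic (its prime values are `±1`; Dirichlet's theorem on primes in
  progressions, as in w3 g3's `EisensteinPair.exists_prime_eq_not_dvd`).

beyond-print theorem: NO. References: [MazurWiles1984] Thm. 2 (p. 216) via [Solomon1990] §I; [Washington1997] §5.1, Cor. 5.15;
[KrizLi2019] §1.5, §2, Thm. 1.20.
-/

set_option autoImplicit false
set_option linter.dupNamespace false

noncomputable section

open scoped Classical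
open DirichletCharacter Literature.NumberTheory.LFunctions Literature.NumberTheory.EllipticCurves.KrizLi2019
  Literature.NumberTheory.EllipticCurves Literature.NumberTheory.EllipticCurves.Rank1Residual

namespace Summit.BirchSwinnertonDyer.BirchSwinnertonDyer.Theorems.PrintCFram.BernoulliUnits

open Summit.BirchSwinnertonDyer.BirchSwinnertonDyer.Theorems.PrintCFram

variable {p : ℕ} [hp : Fact p.Prime]

/-! ## §6 Mazur–Wiles' currency: primitive characters, `generalizedBernoulli 1 χ⁻¹`, parity, and `ω`-exclusion -/

section MazurWilesCurrency

/-- For a PRIMITIVE `χ` (conductor = level), `bernoulliOnePrim χ = B_{1,χ}` itself: the primitive character `χ̃` has the same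
level and the same values. [cite: KrizLi2019, §2 (p. 11, primitive characters) and §1.5 (1)] -/
theorem bernoulliOnePrim_eq_generalizedBernoulli_of_isPrimitive {n : ℕ} [NeZero n] (χ : DirichletCharacter ℚ_[p] n)
    (hχ : χ.IsPrimitive) : bernoulliOnePrim χ = generalizedBernoulli 1 χ := by
  rw [bernoulliOnePrim_def]
  haveI : NeZero χ.conductor := ⟨χ.conductor_ne_zero⟩
  refine RegularLocusBernoulliPair.generalizedBernoulli_congr ((isPrimitive_def χ).mp hχ) χ.primitiveCharacter χ
    (fun a => ?_) 1
  by_cases ha : IsCoprime a (n : ℤ)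
  · exact primitiveCharacter_apply_of_isCoprime χ ha
  · rw [(apply_eq_zero_iff χ a).mpr ha, (apply_eq_zero_iff χ.primitiveCharacter a).mpr (by rwa [(isPrimitive_def χ).mp hχ])]

/-- **`B_{1,χ̃⁻¹} = bernoulliOnePrim χ⁻¹`**: for ANY `χ` mod `n`, the Bernoulli number `generalizedBernoulli 1` of the INVERSE of
the primitive character `χ̃ = χ.primitiveCharacter` (the number Mazur–Wiles' Thm. 2 is stated with, for `χ̃` the Dirichlet avatar)
equals the tree's `bernoulliOnePrim χ⁻¹`: `χ̃⁻¹` is primitive of the same conductor and lifts to `χ⁻¹`.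
[cite: MazurWiles1984, Thm. 2 (p. 216)] [cite: KrizLi2019, §1.5 (1) (p. 7)] -/
theorem generalizedBernoulli_primitiveCharacter_inv {n : ℕ} [NeZero n] (χ : DirichletCharacter ℚ_[p] n) :
    @generalizedBernoulli ℚ_[p] _ _ χ.conductor ⟨χ.conductor_ne_zero⟩ 1 χ.primitiveCharacter⁻¹ = bernoulliOnePrim χ⁻¹ := by
  haveI : NeZero χ.conductor := ⟨χ.conductor_ne_zero⟩
  have hprim : (χ.primitiveCharacter⁻¹).IsPrimitive := by
    rw [isPrimitive_def, conductor_inv]; exact (isPrimitive_def _).mp χ.primitiveCharacter_isPrimitive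
  rw [← bernoulliOnePrim_eq_generalizedBernoulli_of_isPrimitive _ hprim,
    ← RegularLocusBernoulliPair.bernoulliOnePrim_changeLevel χ.conductor_dvd_level (χ.primitiveCharacter⁻¹), map_inv,
    changeLevel_primitiveCharacter]

/-- The primitive character has the parity of `χ` (value at `−1`, coprime to every level). [folklore] -/
theorem primitiveCharacter_odd_iff {n : ℕ} [NeZero n] (χ : DirichletCharacter ℚ_[p] n) :
    χ.primitiveCharacter.Odd ↔ χ.Odd := by
  have h := primitiveCharacter_apply_of_isCoprime χ (a := -1) (Int.isCoprime_iff_gcd_eq_one.mpr (by simp))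
  push_cast at h
  unfold DirichletCharacter.Odd
  rw [h]

/-- The primitive character has the parity of `χ` (even version). [folklore] -/
theorem primitiveCharacter_even_iff {n : ℕ} [NeZero n] (χ : DirichletCharacter ℚ_[p] n) :
    χ.primitiveCharacter.Even ↔ χ.Even := by
  have h := primitiveCharacter_apply_of_isCoprime χ (a := -1) (Int.isCoprime_iff_gcd_eq_one.mpr (by simp))
  push_cast at h
  unfold DirichletCharacter.Even
  rw [h]

/-- **`‖B_{1,ω⁻¹}‖_p = p` for the Teichmüller character `ω` mod `p` (`p` odd).** `B_{1,ω⁻¹} = (1/p)·Σ_{a=1}^{p−1} ω(a)⁻¹·a` and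
`ω(a)⁻¹·a ≡ 1 (mod p)` termwise, so the sum is `≡ p − 1 ≢ 0`: a unit divided by `p`. (The one character excluded by
Mazur–Wiles' Thm. 2 / Herbrand is the one whose Bernoulli number is not even integral.) [cite: Washington1997, §5.1 and Cor. 5.15] -/
theorem norm_generalizedBernoulli_teichmuller_inv (hp2 : p ≠ 2) {ω : DirichletCharacter ℚ_[p] p}
    (hω : IsTeichmullerCharacter ω) : ‖generalizedBernoulli 1 ω⁻¹‖ = (p : ℝ) := by
  have hpp := hp.out
  have hωodd : ω.Odd := KrizLiBinders.teichmuller_apply_neg_one hp2 hω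
  have hne : ω⁻¹ ≠ 1 := by
    apply ne_one_of_odd
    change ω⁻¹ (-1) = -1
    rw [MulChar.inv_apply_eq_inv', hωodd, inv_neg, inv_one]
  rw [generalizedBernoulli_one_eq_sum_div ω⁻¹ hne, norm_div]
  -- the sum is `≡ p − 1 (mod p)`: every non-zero term is `≡ 1`
  have hterm : ∀ j : ZMod p, j ≠ 0 → ‖ω⁻¹ j * ((j.val : ℕ) : ℚ_[p]) - 1‖ < 1 := by
    intro j hj
    have hpj : ¬ ((p : ℤ) ∣ ((j.val : ℕ) : ℤ)) := by
      intro hd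
      have : (((j.val : ℕ) : ℤ) : ZMod p) = 0 := (ZMod.intCast_zmod_eq_zero_iff_dvd _ p).mpr hd
      rw [Int.cast_natCast, ZMod.natCast_zmod_val] at this
      exact hj this
    have hT : ‖ω j - ((j.val : ℕ) : ℚ_[p])‖ < 1 := by
      have := hω _ hpj
      rw [Int.cast_natCast, ZMod.natCast_zmod_val] at this
      push_cast at this
      exact this
    have hω1 : ‖ω j‖ = 1 := by
      have := norm_apply_eq_one ω ((j.val : ℕ) : ℤ) hpj
      rwa [Int.cast_natCast, ZMod.natCast_zmod_val] at this
    have hω0 : ω j ≠ 0 := fun h => by rw [h, norm_zero] at hω1; exact zero_ne_one hω1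
    rw [MulChar.inv_apply_eq_inv']
    have e : (ω j)⁻¹ * ((j.val : ℕ) : ℚ_[p]) - 1 = (ω j)⁻¹ * (((j.val : ℕ) : ℚ_[p]) - ω j) := by
      field_simp
    rw [e, norm_mul, norm_inv, hω1, inv_one, one_mul, norm_sub_rev]
    exact hT
  -- `Σ_j ω⁻¹(j) j = (p − 1) + Σ_{j ≠ 0} (ω⁻¹(j) j − 1)`
  have hsum : ∑ j : ZMod p, ω⁻¹ j * ((j.val : ℕ) : ℚ_[p]) =
      ((p - 1 : ℕ) : ℚ_[p]) + ∑ j ∈ (Finset.univ : Finset (ZMod p)).erase 0, (ω⁻¹ j * ((j.val : ℕ) : ℚ_[p]) - 1) := by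
    rw [← Finset.add_sum_erase _ _ (Finset.mem_univ (0 : ZMod p)), ZMod.val_zero, Nat.cast_zero, mul_zero, zero_add,
      Finset.sum_sub_distrib, Finset.sum_const, Finset.card_erase_of_mem (Finset.mem_univ _), Finset.card_univ,
      ZMod.card, nsmul_eq_mul, mul_one]
    push_cast [Nat.cast_sub hpp.one_lt.le]
    ring
  have hsmall : ‖∑ j ∈ (Finset.univ : Finset (ZMod p)).erase 0, (ω⁻¹ j * ((j.val : ℕ) : ℚ_[p]) - 1)‖ < 1 := by
    haveI : Fact (1 < p) := ⟨hpp.one_lt⟩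
    have hne_set : ((Finset.univ : Finset (ZMod p)).erase 0).Nonempty :=
      ⟨1, Finset.mem_erase.mpr ⟨one_ne_zero, Finset.mem_univ _⟩⟩
    obtain ⟨i, hi, hle⟩ := IsUltrametricDist.exists_norm_finsetSum_le_of_nonempty hne_set
      (fun j => ω⁻¹ j * ((j.val : ℕ) : ℚ_[p]) - 1)
    exact lt_of_le_of_lt hle (hterm i (Finset.mem_erase.mp hi).1)
  have hp1 : ‖((p - 1 : ℕ) : ℚ_[p])‖ = 1 := by
    rw [Padic.norm_natCast_eq_one_iff]
    have : p - 1 < p := Nat.sub_lt hpp.pos Nat.one_pos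
    exact Nat.coprime_of_lt_prime (Nat.sub_ne_zero_of_lt hpp.one_lt) this hpp
  have hnum : ‖∑ j : ZMod p, ω⁻¹ j * ((j.val : ℕ) : ℚ_[p])‖ = 1 := by
    rw [hsum]
    have hne' : ‖((p - 1 : ℕ) : ℚ_[p])‖ ≠
        ‖∑ j ∈ (Finset.univ : Finset (ZMod p)).erase 0, (ω⁻¹ j * ((j.val : ℕ) : ℚ_[p]) - 1)‖ := by
      rw [hp1]; exact (ne_of_lt hsmall).symm
    rw [Padic.add_eq_max_of_ne hne', hp1, max_eq_left hsmall.le]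
  rw [hnum, Padic.norm_p, one_div, inv_inv]

/-- **`ω`-EXCLUSION IS AUTOMATIC.** Mazur–Wiles' Thm. 2 (tree: `MazurWiles1984.thm2_oddChiPart_classGroup_card_eq_pow_val_bernoulli`)
excludes `χ = ω`, spelled `¬ (f = p ∧ ∀ a ⊥ p, ‖χ(a) − a‖ < 1)`. For every consumer holding the UNIT (or just integrality)
statement `‖B_{1,χ⁻¹}‖ ≤ 1` this hypothesis is FREE, since `‖B_{1,ω⁻¹}‖ = p > 1`. [cite: MazurWiles1984, Thm. 2 (p. 216)]
[cite: Washington1997, §5.1 and Cor. 5.15] -/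
theorem not_isTeichmuller_of_norm_generalizedBernoulli_inv_le_one (hp2 : p ≠ 2) {f : ℕ} [NeZero f]
    (χ : DirichletCharacter ℚ_[p] f) (hB : ‖generalizedBernoulli 1 χ⁻¹‖ ≤ 1) :
    ¬ (f = p ∧ ∀ a : ℤ, ¬ ((p : ℤ) ∣ a) → ‖χ (a : ZMod f) - (a : ℚ_[p])‖ < 1) := by
  rintro ⟨rfl, hT⟩
  have h := norm_generalizedBernoulli_teichmuller_inv hp2 (ω := χ) hT
  have h1 : (1 : ℝ) < ‖generalizedBernoulli 1 χ⁻¹‖ := by rw [h]; exact_mod_cast hp.out.one_lt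
  linarith

/-- **`ψ₀ = evenTwist ψ ε_K` is EVEN** whenever `ε_K` is odd (`ψ` even: `ψ₀ = ψ`; `ψ` odd: `ψ₀ = ψ·ε_K`).
[cite: KrizLi2019, §1.5 (p. 7, «the even Dirichlet character ψ₀»)] -/
theorem evenTwist_even {f d : ℕ} [NeZero f] [NeZero d] (ψ : DirichletCharacter ℚ_[p] f)
    {εK : DirichletCharacter ℚ_[p] d} (hε : εK.Odd) : (evenTwist ψ εK).Even := by
  unfold evenTwist DirichletCharacter.Even
  split_ifs with h
  · rw [EisensteinPair.changeLevel_apply_neg_one]; exact h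
  · rw [MulChar.mul_apply, EisensteinPair.changeLevel_apply_neg_one, EisensteinPair.changeLevel_apply_neg_one, hε]
    rcases ψ.even_or_odd with h' | h'
    · exact absurd h' h
    · rw [h']; norm_num

/-- **Kriz–Li's first Bernoulli character `ψ₀⁻¹ε_K` is ODD** (for `ε_K` odd). [cite: KrizLi2019, §1.5 (p. 8, «the two odd Dirichlet characters ψ₀⁻¹ε_K and ψ₀ω⁻¹»)] -/
theorem bernoulliCharOne_odd {f d : ℕ} [NeZero f] [NeZero d] (ψ : DirichletCharacter ℚ_[p] f)
    {εK : DirichletCharacter ℚ_[p] d} (hε : εK.Odd) : (bernoulliCharOne ψ εK).Odd := by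
  have h0 : evenTwist ψ εK (-1) = 1 := evenTwist_even ψ hε
  unfold bernoulliCharOne DirichletCharacter.Odd
  rw [MulChar.mul_apply, MulChar.inv_apply_eq_inv', h0, EisensteinPair.changeLevel_apply_neg_one, hε]
  norm_num

/-- **Kriz–Li's second Bernoulli character `ψ₀ω⁻¹` is ODD** (for `ε_K`, `ω` odd). [cite: KrizLi2019, §1.5 (p. 8, «the two odd Dirichlet characters ψ₀⁻¹ε_K and ψ₀ω⁻¹»)] -/
theorem bernoulliCharTwo_odd {f d : ℕ} [NeZero f] [NeZero d] (ψ : DirichletCharacter ℚ_[p] f)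
    {εK : DirichletCharacter ℚ_[p] d} (hε : εK.Odd) {ω : DirichletCharacter ℚ_[p] p} (hω : ω.Odd) :
    (bernoulliCharTwo ψ εK ω).Odd := by
  have h0 : evenTwist ψ εK (-1) = 1 := evenTwist_even ψ hε
  unfold bernoulliCharTwo DirichletCharacter.Odd
  rw [MulChar.mul_apply, EisensteinPair.changeLevel_apply_neg_one, h0, EisensteinPair.changeLevel_apply_neg_one,
    MulChar.inv_apply_eq_inv', hω]
  norm_num

/-- **A Kronecker character is quadratic: `ε_K⁻¹ = ε_K`.** Its values at the primes `ℓ ∤ d_K` are `±1` (`IsKroneckerCharacterOf`),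
and every unit class modulo `|d_K|` contains such a prime (Dirichlet). [cite: KrizLi2019, §2 (p. 12, «ε_K : (ℤ/d_K)ˣ → μ₂»)] -/
theorem inv_eq_self_of_isKroneckerCharacterOf (K : Type) [Field K] [NumberField K]
    {εK : DirichletCharacter ℚ_[p] (NumberField.discr K).natAbs} (hε : IsKroneckerCharacterOf K εK) :
    εK⁻¹ = εK := by
  haveI : NeZero (NumberField.discr K).natAbs := ⟨Int.natAbs_ne_zero.mpr (NumberField.discr_ne_zero K)⟩
  rw [inv_eq_iff_mul_eq_one]
  apply MulChar.ext
  intro u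
  obtain ⟨ℓ, hℓ, hℓd, hℓu⟩ := EisensteinPair.exists_prime_eq_not_dvd u (N := (NumberField.discr K).natAbs) (NeZero.ne _)
  have hℓd' : ¬ ((ℓ : ℤ) ∣ NumberField.discr K) := fun h => hℓd (Int.natCast_dvd.mp h)
  have hv := hε.2 ℓ hℓ hℓd'
  rw [MulChar.mul_apply, MulChar.one_apply_coe, ← hℓu, hv]
  split_ifs <;> norm_num

end MazurWilesCurrency

end Summit.BirchSwinnertonDyer.BirchSwinnertonDyer.Theorems.PrintCFram.BernoulliUnits

end
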